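import Mathlib
import Summits.CriticalPhenomena.CardyFormulaZ2.Theorems.CardyMagicRigidityNestingRigidityBondTranslation
import Literature.Probability.Percolation.LoopRepresentationProofs
import Literature.Probability.Percolation.LoopRotationInvarianceAssembly
import HarnessLib

/-!
# Crux `NestingRigidity`, line `ring-cloud-tomography` (r5): point reflections of `ℤ²` act on
# the typed loop representation of bond-`ℤ²` by reflecting the loops; dipole counts are symmetric

Crux `Summit.CriticalPhenomena.CardyFormulaZ2.Theses.CardyMagicRigidity.NestingRigidity`
(stmt-CriticalPhenomena-4835), line `ring-cloud-tomography`, stub R1'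
`stub_uvDecoupling : ∀ E ∈ latticeEnsembles, UVDecoupling E` — second half of the SYMMETRY layer
of the first-moment identity on `ℤ²` (companion of `…BondTranslation`; the `𝕋` analogue is
`loops_siteLoopConfig_reflect` / `integral_ncard_sep_symm` of crux `MagicFormulaT`).  For every
lattice vector `c ∈ ℤ²` the point reflection `v ↦ c − v` (`Equiv.subLeft c`; centre `δc/2`: a
site, an edge midpoint or a face centre) is an ORIENTATION-PRESERVING symmetry of `ℤ²` and of its
medial structure (faces `f ↦ c − 1 − f` in lower-left-corner indexing).  Configuration by
configuration, exact, no cited fact, no definition: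

* §1 corners, the turning rule (`isMedialTurn_relabel_reflect_iff`; the dual-edge clause is read
  through the injectivity of `dualEdge`: `dualEdge e ∈ dualConfig ω ↔ e ∈ E(ℤ²) ∧ e ∉ ω`) and
  interface loops (`isInterfaceLoop_map_reflect`) transport along `σ_c = sym2Equiv (Equiv.subLeft c)`;
* §2 drawn loops reflect (`loopCurve_map_reflect`, plane map `z ↦ −z + δc`), types are kept
  (`loopType_map_reflect`: the reflection has determinant `+1`), winding numbers are invariant
  (`wind_map_pointReflect`);
* §3 EQUIVARIANCE (registered anchor `bondLoopConfig_relabel_reflect`):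
  `bondLoopConfig δ 0 (σ_c ω) = (bondLoopConfig δ 0 ω).map (z ↦ −z + δc)`, hence for the loop sets
  of `zEns`; `ω ↦ σ_c ω` preserves `P_{1/2}` (`bondPercolation_map_relabel_iso`), so the law of the
  loop set of `zEns` is invariant under every such reflection (`integral_comp_reflect_loops_zEns`);
* §4 **DIPOLE SYMMETRY on `ℤ²`** (`integral_ncard_dipole_symm_zEns`): for points `x, y` with
  `x + y = δc`, `c ∈ ℤ²` (two sites, or two face centres, of `δℤ²`),
  `E #{u : W(u,x) ≠ 0, W(u,y) = 0} = E #{u : W(u,y) ≠ 0, W(u,x) = 0}` — the mean nesting-count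
  difference between two sites (or two face centres) VANISHES; with `…BondTranslation` this is
  the whole lattice-symmetry input of the centring of the cone phases on `ℤ²` (what it does not
  give is the site-versus-face-centre comparison, which is self-duality).
-/

noncomputable section

open MeasureTheory Set Filter Metric
open scoped Real Topology BigOperators

namespace Summit.CriticalPhenomena.CardyFormulaZ2.Cruxes.NestingRigidity.RingCloudTomography

open Literature.Probability.RandomPlanarGeometry Literature.Probability.Percolation
  Literature.Probability.LatticeModels

namespace BondReflection

/-- The point reflection `z ↦ −z + p` of the plane is continuous … -/
theorem continuous_pointReflect (p : ℂ) : Continuous fun z : ℂ ↦ -1 * z + p := by fun_prop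

/-- … and an isometry. -/
theorem isometry_pointReflect (p : ℂ) : Isometry fun z : ℂ ↦ -1 * z + p :=
  Isometry.of_dist_eq fun a b ↦ by
    rw [dist_eq_norm, dist_eq_norm, show -1 * a + p - (-1 * b + p) = -(a - b) by ring, norm_neg]

/-- The point reflection `z ↦ −z + p` of the plane as a continuous map (local notation). -/
local notation3 "S[" p "]" => (⟨fun z : ℂ ↦ -1 * z + (p : ℂ), continuous_pointReflect p⟩ : C(ℂ, ℂ))

/-- The point reflection `v ↦ c − v` of `ℤ²` acting on medial vertices (local notation). -/
local notation3 "σ[" c "]" => sym2Equiv (Equiv.subLeft (c : Site 2))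

/-! ## §1 Corners, medial turns and interface loops under the point reflections of `ℤ²` -/

section Sites

variable (v f c : Site 2)

/-- `σ_c` on a pair of sites. -/
theorem reflect_mk (x y : Site 2) : σ[c] s(x, y) = s(c - x, c - y) := by
  rw [sym2Equiv_mk, Equiv.subLeft_apply, Equiv.subLeft_apply]

/-- `σ_c` is an involution. -/
theorem reflect_reflect (e : Sym2 (Site 2)) : σ[c] (σ[c] e) = e := by
  induction e using Sym2.ind with
  | h x y => rw [reflect_mk, reflect_mk, sub_sub_cancel, sub_sub_cancel]

/-- Being a corner is reflection invariant: the corner `v` of the face `f` goes to the corner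
`c − v` of the face `c − 1 − f`. -/
theorem isCorner_reflect_iff : IsCorner (c - v) (c - 1 - f) ↔ IsCorner v f :=
  forall_congr' fun i ↦ by simp only [Pi.sub_apply, Pi.one_apply]; omega

/-- `cornerEdge` commutes with the reflection. -/
theorem cornerEdge_reflect (i : Fin 2) : cornerEdge (c - v) (c - 1 - f) i = σ[c] (cornerEdge v f i) := by
  have h : cornerNeighbor (c - v) (c - 1 - f) i = c - cornerNeighbor v f i := by
    ext j
    by_cases hj : j = i
    · subst hj; simp only [cornerNeighbor, Function.update_self, Pi.sub_apply, Pi.one_apply]; ring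
    · simp only [cornerNeighbor, Function.update_of_ne hj, Pi.sub_apply]
  rw [cornerEdge, cornerEdge, h, reflect_mk]

/-- `cornerSource` and `cornerTarget` commute with the reflection (a rotation by `π` keeps the
primal vertex on the left: no source/target swap). -/
theorem cornerSource_reflect_and : cornerSource (c - v) (c - 1 - f) = σ[c] (cornerSource v f) ∧
    cornerTarget (c - v) (c - 1 - f) = σ[c] (cornerTarget v f) := by
  have hd : (c - v) 0 - (c - 1 - f) 0 = (c - v) 1 - (c - 1 - f) 1 ↔ v 0 - f 0 = v 1 - f 1 := by
    simp only [Pi.sub_apply, Pi.one_apply]; omega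
  simp only [cornerSource, cornerTarget, hd, cornerEdge_reflect, apply_ite (sym2Equiv (Equiv.subLeft c)),
    and_self]

/-- The reflection preserves adjacency in `ℤ²`. -/
theorem zdGraph_adj_reflect_iff (x y : Site 2) : (zdGraph 2).Adj (c - x) (c - y) ↔ (zdGraph 2).Adj x y := by
  simp only [zdGraph_adj_iff]
  refine exists_congr fun i ↦ ?_
  constructor
  · rintro (h | h)
    · exact Or.inr (by linear_combination h)
    · exact Or.inl (by linear_combination h)
  · rintro (h | h)
    · exact Or.inr (by linear_combination h)
    · exact Or.inl (by linear_combination h)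

/-- The reflection preserves the edges of `ℤ²`. -/
theorem reflect_mem_edgeSet_iff (e : Sym2 (Site 2)) : σ[c] e ∈ (zdGraph 2).edgeSet ↔ e ∈ (zdGraph 2).edgeSet :=
  sym2Equiv_mem_edgeSet_iff (G := zdGraph 2) (G' := zdGraph 2)
    { toEquiv := Equiv.subLeft c, map_rel_iff' := fun {a b} ↦ zdGraph_adj_reflect_iff c a b } e

/-- `σ_c z ∈ σ_c ω ↔ z ∈ ω`. -/
theorem reflect_mem_relabel_reflect_iff (ω : BondConfig (Site 2)) (z : Sym2 (Site 2)) :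
    σ[c] z ∈ BondConfig.relabel σ[c] ω ↔ z ∈ ω := by
  rw [BondConfig.mem_relabel_iff, Equiv.symm_apply_apply]

/-- Reflecting a configuration twice gives it back. -/
theorem relabel_reflect_relabel_reflect (ω : BondConfig (Site 2)) :
    BondConfig.relabel σ[c] (BondConfig.relabel σ[c] ω) = ω := by
  ext z
  rw [← reflect_reflect c z, reflect_mem_relabel_reflect_iff, reflect_mem_relabel_reflect_iff, reflect_reflect]

/-- **The dual-edge clause of the turning rule, through the injectivity of `dualEdge`**:
`dualEdge e ∈ dualConfig ω ↔ e ∈ E(ℤ²) ∧ e ∉ ω`. -/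
theorem dualEdge_mem_dualConfig_iff' (ω : BondConfig (Site 2)) (e : Sym2 (Site 2)) :
    dualEdge e ∈ dualConfig ω ↔ e ∈ (zdGraph 2).edgeSet ∧ e ∉ ω := by
  rw [mem_dualConfig_iff]
  refine and_congr ⟨fun h ↦ by_contra fun he ↦ ?_, fun h ↦ dualEdge_mem_edgeSet_holds h⟩
    ⟨fun h he ↦ h e he rfl, fun h e' he' heq ↦ h (dualEdge_bijective.1 heq ▸ he')⟩
  rw [dualEdge_of_not_mem he] at h
  exact he h

/-- **The turning rule is reflection covariant** (corners `(v, f) ↦ (c − v, c − 1 − f)`). -/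
theorem isMedialTurn_relabel_reflect_iff (ω : BondConfig (Site 2)) (e₀ e₁ e₂ : MedialVertex) :
    IsMedialTurn (BondConfig.relabel σ[c] ω) (σ[c] e₀) (σ[c] e₁) (σ[c] e₂) ↔ IsMedialTurn ω e₀ e₁ e₂ := by
  have key : dualEdge (σ[c] e₁) ∈ dualConfig (BondConfig.relabel σ[c] ω) ↔ dualEdge e₁ ∈ dualConfig ω := by
    rw [dualEdge_mem_dualConfig_iff', dualEdge_mem_dualConfig_iff', reflect_mem_edgeSet_iff,
      reflect_mem_relabel_reflect_iff]
  have inj := (sym2Equiv (Equiv.subLeft c)).injective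
  constructor
  · rintro ⟨v₁', f₁', v₂', f₂', hc₁, hs₁, ht₁, hc₂, hs₂, ht₂, hlast⟩
    obtain ⟨v₁, rfl⟩ : ∃ v, c - v = v₁' := ⟨c - v₁', sub_sub_cancel c v₁'⟩
    obtain ⟨f₁, rfl⟩ : ∃ f, c - 1 - f = f₁' := ⟨c - 1 - f₁', sub_sub_cancel _ f₁'⟩
    obtain ⟨v₂, rfl⟩ : ∃ v, c - v = v₂' := ⟨c - v₂', sub_sub_cancel c v₂'⟩
    obtain ⟨f₂, rfl⟩ : ∃ f, c - 1 - f = f₂' := ⟨c - 1 - f₂', sub_sub_cancel _ f₂'⟩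
    rw [(cornerSource_reflect_and _ _ c).1] at hs₁ hs₂; rw [(cornerSource_reflect_and _ _ c).2] at ht₁ ht₂
    rw [isCorner_reflect_iff] at hc₁ hc₂
    rw [sub_right_inj, sub_right_inj, key, reflect_mem_relabel_reflect_iff] at hlast
    exact ⟨v₁, f₁, v₂, f₂, hc₁, inj hs₁, inj ht₁, hc₂, inj hs₂, inj ht₂, hlast⟩
  · rintro ⟨v₁, f₁, v₂, f₂, hc₁, rfl, rfl, hc₂, hs₂, rfl, hlast⟩
    exact ⟨c - v₁, c - 1 - f₁, c - v₂, c - 1 - f₂, (isCorner_reflect_iff _ _ _).2 hc₁,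
      (cornerSource_reflect_and _ _ _).1, (cornerSource_reflect_and _ _ _).2, (isCorner_reflect_iff _ _ _).2 hc₂,
      by rw [(cornerSource_reflect_and _ _ _).1, hs₂], (cornerSource_reflect_and _ _ _).2,
      by rwa [sub_right_inj, sub_right_inj, key, reflect_mem_relabel_reflect_iff]⟩

/-- The mesh point of a reflected site: `δ(c − v) = δc − δv`. -/
theorem meshPoint_reflect (δ : ℝ) (x : Site 2) : meshPoint δ (c - x) = meshPoint δ c - meshPoint δ x := by
  have h : Site.toComplex (c - x) = Site.toComplex c - Site.toComplex x := Complex.ext (by simp) (by simp)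
  rw [meshPoint, meshPoint, meshPoint, h, mul_sub]

/-- The medial point of a reflected medial vertex is the reflected medial point:
`medialPoint δ (σ_c e) = −medialPoint δ e + δc`. -/
theorem medialPoint_reflect (δ : ℝ) (e : MedialVertex) :
    medialPoint δ (σ[c] e) = -1 * medialPoint δ e + meshPoint δ c := by
  induction e using Sym2.ind with
  | h x y => rw [reflect_mk, medialPoint_mk, medialPoint_mk, meshPoint_reflect, meshPoint_reflect]; ring

end Sites

/-- **The reflection of an interface loop is an interface loop of the reflected configuration**
(forward transport `isInterfaceLoop_map_of_turn` with the covariant turning rule) … -/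
theorem isInterfaceLoop_map_reflect (c : Site 2) {ω : BondConfig (Site 2)} {γ : List MedialVertex}
    (h : IsInterfaceLoop ω γ) : IsInterfaceLoop (BondConfig.relabel σ[c] ω) (γ.map σ[c]) :=
  BondTranslation.isInterfaceLoop_map_of_turn (sym2Equiv _).injective
    (fun ht ↦ (isMedialTurn_relabel_reflect_iff c ω _ _ _).2 ht) h

/-- On dart lists, reflecting twice is the identity. -/
theorem map_reflect_map_reflect (c : Site 2) (γ : List MedialVertex) : (γ.map σ[c]).map σ[c] = γ := by
  rw [List.map_map]
  convert List.map_id γ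
  exact funext (reflect_reflect c)

/-- … and conversely: an interface loop of the reflected configuration is a reflected interface
loop (reflect once more). -/
theorem isInterfaceLoop_map_of_relabel_reflect (c : Site 2) {ω : BondConfig (Site 2)}
    {γ' : List MedialVertex} (h : IsInterfaceLoop (BondConfig.relabel σ[c] ω) γ') :
    IsInterfaceLoop ω (γ'.map σ[c]) := by
  have h' := isInterfaceLoop_map_reflect c h
  rwa [relabel_reflect_relabel_reflect] at h'

/-! ## §2 Geometry: drawn loops, types and winding numbers under the point reflection -/

/-- **The drawn loop of the reflected dart list is the reflected drawn loop** (mesh `δ`, angle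
`0`; plane map `z ↦ −z + δc`, affine on segments). -/
theorem loopCurve_map_reflect (δ : ℝ) (c : Site 2) {γ : List MedialVertex} (hγ : γ ≠ []) :
    loopCurve δ 0 (γ.map σ[c]) = (loopCurve δ 0 γ).map S[meshPoint δ c] := by
  set p : ℂ := meshPoint δ c with hp
  have hl : ((γ.map σ[c]) ++ (γ.map σ[c]).take 1).map (medialPoint δ) =
      ((γ ++ γ.take 1).map (medialPoint δ)).map fun z ↦ -1 * z + p := by
    rw [← List.map_take, ← List.map_append, List.map_map, List.map_map]
    exact List.map_congr_left fun e _ ↦ by simp only [Function.comp_apply, medialPoint_reflect c δ, hp]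
  rw [loopCurve_zero, loopCurve_zero, hl, CurveClass.map_mk]; congr 1
  set L := (γ ++ γ.take 1).map (medialPoint δ) with hL
  have hne : L ≠ [] := by simp [hL, hγ]
  obtain ⟨a, l, hal⟩ := List.exists_cons_of_ne_nil hne
  ext t
  change polyline (L.map fun z ↦ -1 * z + p) t = -1 * polyline L t + p
  rw [hal, List.map_cons]
  exact (apply_polylineFrom (fun z : ℂ ↦ -1 * z + p) (fun x y s ↦ by
    simp only [AffineMap.lineMap_apply_module, Complex.real_smul]; push_cast; ring) a l t).symm

/-- The same for unbased loops. -/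
theorem unbasedLoop_loopCurve_map_reflect (δ : ℝ) (c : Site 2) {γ : List MedialVertex} (hγ : γ ≠ [])
    (h₁ : (loopCurve δ 0 (γ.map σ[c])).IsLoop) (h₂ : (loopCurve δ 0 γ).IsLoop) :
    UnbasedLoop.mk (BasedLoop.mk (loopCurve δ 0 (γ.map σ[c])) h₁) =
      (UnbasedLoop.mk (BasedLoop.mk (loopCurve δ 0 γ) h₂)).map S[meshPoint δ c]
        (isometry_pointReflect (meshPoint δ c)) := by
  rw [UnbasedLoop.map_mk, BasedLoop.map_mk]
  exact congrArg UnbasedLoop.mk (BasedLoop.mk_eq_mk.2 (loopCurve_map_reflect δ c hγ))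

/-- **The reflection keeps the shoelace area** (determinant `+1`) … -/
theorem loopSignedArea_map_reflect (c : Site 2) (γ : List MedialVertex) :
    loopSignedArea (γ.map σ[c]) = loopSignedArea γ := by
  rw [loopSignedArea, loopSignedArea, List.map_map]
  have h : γ.map (medialPoint 1 ∘ σ[c]) = ((γ.map (medialPoint 1)).map fun z ↦ -z).map (meshPoint 1 c + ·) := by
    rw [List.map_map, List.map_map]
    exact List.map_congr_left fun e _ ↦ by simp only [Function.comp_apply, medialPoint_reflect c 1]; ring
  rw [h, shoelace_map_const_add, shoelace_map_of_det (fun z : ℂ ↦ -z) 1 (fun p q ↦ by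
    simp only [Complex.neg_re, Complex.neg_im]; ring), one_mul]

/-- … hence the orientation type. -/
theorem loopType_map_reflect (c : Site 2) (γ : List MedialVertex) : loopType (γ.map σ[c]) = loopType γ := by
  rw [loopType, loopType, loopSignedArea_map_reflect]

/-- **Winding numbers are invariant under point reflections**: `W(−u + p, −z + p) = W(u, z)`. -/
theorem wind_map_pointReflect (u : UnbasedLoop ℂ) (p z : ℂ) :
    (u.map S[p] (isometry_pointReflect p)).wind (-1 * z + p) = u.wind z := by
  obtain ⟨⟨k, hk⟩, rfl⟩ := UnbasedLoop.mk_surjective u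
  rw [UnbasedLoop.map_mk, UnbasedLoop.wind_mk, UnbasedLoop.wind_mk]
  exact CurveClass.wind_map_affine k (neg_ne_zero.2 one_ne_zero) p z

/-- The same read at the reflected point: `W(−u + p, z) = W(u, −z + p)`. -/
theorem wind_map_pointReflect' (u : UnbasedLoop ℂ) (p z : ℂ) :
    (u.map S[p] (isometry_pointReflect p)).wind z = u.wind (-1 * z + p) := by
  rw [← wind_map_pointReflect u p (-1 * z + p)]; congr 1; ring

/-- Reflecting loops is an involution … -/
theorem map_pointReflect_map_pointReflect (u : UnbasedLoop ℂ) (p : ℂ) :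
    (u.map S[p] (isometry_pointReflect p)).map S[p] (isometry_pointReflect p) = u := by
  obtain ⟨ℓ, rfl⟩ := UnbasedLoop.mk_surjective u
  rw [UnbasedLoop.map_mk, UnbasedLoop.map_mk, BasedLoop.map_map]
  have hid : (S[p]).comp S[p] = ContinuousMap.id ℂ := by ext w; simp
  rw [hid, BasedLoop.map_id]

/-- … hence injective. -/
theorem map_pointReflect_injective (p : ℂ) : Function.Injective (UnbasedLoop.map S[p] (isometry_pointReflect p)) :=
  fun u v h ↦ by
    rw [← map_pointReflect_map_pointReflect u p, ← map_pointReflect_map_pointReflect v p]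
    exact congrArg (UnbasedLoop.map S[p] (isometry_pointReflect p)) h

end BondReflection

open BondReflection in
/-- **Point reflections of `ℤ²` act on the typed loop representation of bond-`ℤ²` by reflecting
the loops** (registered helper toward stub R1' `stub_uvDecoupling`, line `ring-cloud-tomography`
r5; second half of the symmetry layer of the first-moment identity on `ℤ²`).  For every mesh `δ`,
lattice vector `c ∈ ℤ²` and configuration `ω`, the typed loop configuration of the reflected
configuration `BondConfig.relabel (sym2Equiv (Equiv.subLeft c)) ω` (`v ↦ c − v` on sites) is the
push-forward of the typed loop configuration of `ω` along the point reflection `z ↦ −z + δc` of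
the plane: interface loops reflect (`isInterfaceLoop_map_reflect`), drawn loops reflect
(`loopCurve_map_reflect`), types are kept (`loopType_map_reflect`). -/
theorem bondLoopConfig_relabel_reflect : ∀ (δ : ℝ) (c : Site 2) (ω : BondConfig (Site 2)),
    bondLoopConfig δ 0 (BondConfig.relabel (sym2Equiv (Equiv.subLeft c)) ω) =
      (bondLoopConfig δ 0 ω).map ⟨fun z : ℂ ↦ -1 * z + meshPoint δ c, BondReflection.continuous_pointReflect (meshPoint δ c)⟩
        (BondReflection.isometry_pointReflect (meshPoint δ c)) := by
  intro δ c ω; ext i u; simp only [mem_bondLoopConfig_iff, LoopConfig.mem_map_iff]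
  constructor
  · rintro ⟨γ', h', ht, rfl⟩
    have h : IsInterfaceLoop ω (γ'.map (sym2Equiv (Equiv.subLeft c))) := isInterfaceLoop_map_of_relabel_reflect c h'
    have hback := map_reflect_map_reflect c γ'
    refine ⟨_, ⟨_, h, by rw [← loopType_map_reflect c, hback, ht], rfl⟩, ?_⟩
    have h₁ : (loopCurve δ 0 ((γ'.map (sym2Equiv (Equiv.subLeft c))).map (sym2Equiv (Equiv.subLeft c)))).IsLoop := by
      rw [hback]; exact isLoop_loopCurve δ 0 h'.ne_nil
    rw [← unbasedLoop_loopCurve_map_reflect δ c h.ne_nil h₁ (isLoop_loopCurve δ 0 h.ne_nil)]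
    exact congrArg UnbasedLoop.mk (BasedLoop.mk_eq_mk.2 (by rw [hback]))
  · rintro ⟨_, ⟨γ, h, ht, rfl⟩, rfl⟩
    exact ⟨γ.map (sym2Equiv (Equiv.subLeft c)), isInterfaceLoop_map_reflect c h, by rw [loopType_map_reflect, ht],
      (unbasedLoop_loopCurve_map_reflect δ c h.ne_nil _ (isLoop_loopCurve δ 0 h.ne_nil)).symm⟩

namespace BondReflection

/-- The point reflection `z ↦ −z + p` (local notation, re-declared after the anchor). -/
local notation3 "S[" p "]" => (⟨fun z : ℂ ↦ -1 * z + (p : ℂ), continuous_pointReflect p⟩ : C(ℂ, ℂ))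

/-- The point reflection `v ↦ c − v` of `ℤ²` on medial vertices (local notation, re-declared). -/
local notation3 "σ[" c "]" => sym2Equiv (Equiv.subLeft (c : Site 2))

/-! ## §3 The loop sets and the loop law of `zEns` under the point reflections -/

/-- **The loops of `zEns` at mesh `δ` of the reflected configuration are the reflected loops.** -/
theorem loops_zEns_relabel_reflect (δ : ℝ) (c : Site 2) (ω : BondConfig (Site 2)) :
    (zEns.X δ (BondConfig.relabel σ[c] ω)).loops =
      UnbasedLoop.map S[meshPoint δ c] (isometry_pointReflect (meshPoint δ c)) '' (zEns.X δ ω).loops := by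
  change (bondLoopConfig δ 0 _).loops = UnbasedLoop.map _ _ '' (bondLoopConfig δ 0 ω).loops
  rw [bondLoopConfig_relabel_reflect, BondTranslation.loops_map]

/-- **`ω ↦ σ_c ω` preserves `zEns.P = P_{1/2}`** (isomorphism invariance of bond percolation). -/
theorem measurePreserving_relabel_reflect_zEns (c : Site 2) :
    MeasurePreserving (BondConfig.relabel σ[c]) zEns.P zEns.P :=
  ⟨(BondConfig.relabel _).measurable, bondPercolation_map_relabel_iso (G := zdGraph 2) (G' := zdGraph 2)
    { toEquiv := Equiv.subLeft c, map_rel_iff' := fun {a b} ↦ zdGraph_adj_reflect_iff c a b } half⟩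

/-- Change of variables: `∫ F(σ_c ω) dP = ∫ F dP` for EVERY real `F` (no measurability needed). -/
theorem integral_comp_relabel_reflect_zEns (c : Site 2) (F : BondConfig (Site 2) → ℝ) :
    ∫ ω, F (BondConfig.relabel σ[c] ω) ∂zEns.P = ∫ ω, F ω ∂zEns.P :=
  (measurePreserving_relabel_reflect_zEns c).integral_comp' F

/-- **The law of the loop set of `zEns` is invariant under the point reflections `z ↦ −z + δc`,
`c ∈ ℤ²`**: `∫ G((−· + δc) '' loops) dP = ∫ G(loops) dP` for EVERY real statistic `G`. -/
theorem integral_comp_reflect_loops_zEns (δ : ℝ) (c : Site 2) (G : Set (UnbasedLoop ℂ) → ℝ) :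
    ∫ ω, G (UnbasedLoop.map S[meshPoint δ c] (isometry_pointReflect (meshPoint δ c)) ''
        (zEns.X δ ω).loops) ∂zEns.P = ∫ ω, G (zEns.X δ ω).loops ∂zEns.P := by
  rw [← integral_comp_relabel_reflect_zEns c fun ω ↦ G (zEns.X δ ω).loops]
  simp only [loops_zEns_relabel_reflect]

/-! ## §4 Dipole counts are symmetric under the point reflections -/

/-- Pathwise: the reflected loops winding around `x` and not around `y` are the reflections of the
loops winding around `−x + p` and not around `−y + p`. -/
theorem ncard_dipole_map_pointReflect (p x y : ℂ) (L : Set (UnbasedLoop ℂ)) :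
    {u ∈ UnbasedLoop.map S[p] (isometry_pointReflect p) '' L | u.wind x ≠ 0 ∧ u.wind y = 0}.ncard =
      {u ∈ L | u.wind (-1 * x + p) ≠ 0 ∧ u.wind (-1 * y + p) = 0}.ncard := by
  have h : {u ∈ UnbasedLoop.map S[p] (isometry_pointReflect p) '' L | u.wind x ≠ 0 ∧ u.wind y = 0} =
      UnbasedLoop.map S[p] (isometry_pointReflect p) '' {u ∈ L | u.wind (-1 * x + p) ≠ 0 ∧ u.wind (-1 * y + p) = 0} := by
    ext u
    constructor
    · rintro ⟨⟨v, hv, rfl⟩, hq⟩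
      exact ⟨v, ⟨hv, by rwa [wind_map_pointReflect', wind_map_pointReflect'] at hq⟩, rfl⟩
    · rintro ⟨v, ⟨hv, hq⟩, rfl⟩
      exact ⟨⟨v, hv, rfl⟩, by rwa [wind_map_pointReflect', wind_map_pointReflect']⟩
  rw [h, Set.ncard_image_of_injective _ (map_pointReflect_injective p)]

/-- **DIPOLE SYMMETRY ON `ℤ²`.**  For every mesh `δ`, lattice vector `c ∈ ℤ²` and points `x, y`
symmetric about `δc/2` (`x + y = δc`: two sites, or two face centres, of `δℤ²`), the mean number
of loops of `zEns` winding around `x` but not `y` equals the mean number winding around `y` but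
not `x`: `E #{u : W(u,x) ≠ 0, W(u,y) = 0} = E #{u : W(u,y) ≠ 0, W(u,x) = 0}` (the point reflection
through `δc/2` swaps the two families and preserves `P_{1/2}`; no integrability needed). -/
theorem integral_ncard_dipole_symm_zEns (δ : ℝ) (c : Site 2) {x y : ℂ} (hxy : x + y = meshPoint δ c) :
    ∫ ω, ({u ∈ (zEns.X δ ω).loops | u.wind x ≠ 0 ∧ u.wind y = 0}.ncard : ℝ) ∂zEns.P =
      ∫ ω, ({u ∈ (zEns.X δ ω).loops | u.wind y ≠ 0 ∧ u.wind x = 0}.ncard : ℝ) ∂zEns.P := by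
  rw [← integral_comp_relabel_reflect_zEns c fun ω ↦ ({u ∈ (zEns.X δ ω).loops | u.wind x ≠ 0 ∧ u.wind y = 0}.ncard : ℝ)]
  refine integral_congr_ae (Eventually.of_forall fun ω ↦ ?_)
  have hx : -1 * x + meshPoint δ c = y := by rw [← hxy]; ring
  have hy : -1 * y + meshPoint δ c = x := by rw [← hxy]; ring
  simp only [loops_zEns_relabel_reflect, ncard_dipole_map_pointReflect, hx, hy]

/-- In particular (`c = 0`, then translate): the mean dipole count of `zEns` is EVEN,
`E #{u : W(u,x) ≠ 0, W(u,−x) = 0} = E #{u : W(u,−x) ≠ 0, W(u,x) = 0}`. -/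
theorem integral_ncard_dipole_neg_zEns (δ : ℝ) (x : ℂ) :
    ∫ ω, ({u ∈ (zEns.X δ ω).loops | u.wind x ≠ 0 ∧ u.wind (-x) = 0}.ncard : ℝ) ∂zEns.P =
      ∫ ω, ({u ∈ (zEns.X δ ω).loops | u.wind (-x) ≠ 0 ∧ u.wind x = 0}.ncard : ℝ) ∂zEns.P :=
  integral_ncard_dipole_symm_zEns δ 0 (by
    rw [add_neg_cancel, meshPoint, show Site.toComplex (0 : Site 2) = 0 from Complex.ext (by simp) (by simp),
      mul_zero])

end BondReflection

end Summit.CriticalPhenomena.CardyFormulaZ2.Cruxes.NestingRigidity.RingCloudTomography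

end
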